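import Literature.NumberTheory.EllipticCurves.BSDSelmerParityDokchitserProofs
import Literature.NumberTheory.EllipticCurves.ZpExtension
import HarnessLib

/-!
# bsd.S19, step (4): the `p`-parity congruence over the Heegner field along the printed proof
(decomposition of `Literature.NumberTheory.EllipticCurves.dokchitser_selmerCorank_baseChange_mod_two_eq`)

Fourth file of the bsd.S19 cluster (`BSDSelmerParityProofs`, `BSDSelmerParityDokchitserProofs`,
`BSDSelmerPParityProofs`). The named fact `dokchitser_selmerCorank_baseChange_mod_two_eq`
(`BSDSelmerParityDokchitserProofs`) is step (4) of T. Dokchitser, V. Dokchitser, *On the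
Birch–Swinnerton-Dyer quotients modulo squares*, Ann. of Math. 172 (2010), 567–596, §4.6, proof of
Thm. 4.19 (= Thm. 1.4), in its 2026-08-15 form: for an elliptic curve `E/ℚ`, an odd prime `p` and
an imaginary quadratic field `M₀` in which all bad primes of `E` split, `rk_p(E/M₀)` is odd (what
"so it suffices to prove it for `E/M₀`" establishes, the root number of `E/M₀` being `-1`). The
printed proof for `E/M₀` (p. 26, "Let `M_n` denote the `n`-th layer in the anticyclotomic
`ℤ_p`-extension of `M₀`" to the end of the proof on p. 27) is a theory of its own — Lemma 4.14 and
Cor. 4.15 (Selmer groups in Galois extensions), Prop. 4.17 (the `D_{2p}` computation through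
Cor. 4.5 and Thm. 4.7, i.e. Thm. 4.3 = the Tate–Milne isogeny-invariance argument for the BSD
quotient with Selmer groups, the Cassels–Tate pairing and isogenies between Weil restrictions,
§§4.1–4.3), Cornut–Vatsal's non-triviality theorem in the anticyclotomic tower with
Yuan–Zhang–Zhang's Gross–Zagier formula and Tian–Zhang's / Nekovář's Kolyvagin bound for CM
points — none of which is in the tree, and none of which is
restated here as a named fact (D-0026: a `provefact` unit proves with inline lemmas or reduces to
EXPLICIT hypotheses; it mints no `def … : Prop`). This file PROVES the printed assembly as a
reduction theorem whose hypotheses are the three printed inputs, each transcribed so that only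
`p^∞`-Selmer coranks of base changes occur (`WeierstrassCurve.selmerCorank`, file `Selmer`), over
the layers `M_n = κ.layer n` of an anticyclotomic `ℤ_p`-extension `κ : ZpExtension M₀ p` (file
`ZpExtension`, `ZpExtension.IsAnticyclotomic`):

* `h415` — Cor. 4.15 (p. 24): the parity of `rk_p` is unchanged in a Galois extension of (prime)
  degree `p` of number fields (`p` odd);
* `h417` — p. 27, from "decompose `X = X_p(E/F) ≅ 1^{m_1} ⊕ ε^{m_ε} ⊕ ρ^{m_ρ}`" to "it suffices
  to show that `m_ρ` is odd" (Lemma 4.14 and Prop. 4.17, and "since all bad primes of `E` split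
  in `M/K` [...] both `C(E/F)` and `C(E/M)` are squares"): `rk_p(E/M_n) + m_ρ` is even, where
  `(p - 1) m_ρ = rk_p(E/M_{n+1}) - rk_p(E/M_n)`;
* `hCV` — p. 27, "Now take `n` large enough" to "`m_ρ = p^n` is odd" (Cornut–Vatsal 2007,
  Thm. 1.5 with Yuan–Zhang–Zhang, and Tian–Zhang; or Cornut–Vatsal Thm. 4.2 with Nekovář 2007,
  Thm. 3.2): `rk_p(E/M_{n+1}) = rk_p(E/M_n) + (p-1)p^n` for all large `n`.

The proved part: the layers are number fields, Galois over `M₀`, consecutive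
layers being Galois of degree `p` (`ZpExtension.finrank_layer_holds`, `isGalois_layer_holds`), so
Cor. 4.15 climbs the tower (`selmerCorank_layer_succ_mod_two_eq`); with the anticyclotomic
`ℤ_p`-extension of `M₀` (tree fact `ZpExtension.exists_isAnticyclotomic`, reduced in
`ZpExtensionAnticyclotomicProofs` to the `ℤ_p`-rank count of class field theory) this gives
"`rk_p(E/M₀)` is odd", i.e. the target fact in its 2026-08-15 form
(`odd_selmerCorank_baseChange_of_anticyclotomic_of_printed`,
`dokchitser_selmerCorank_baseChange_mod_two_eq_of_printed`),
and hence Thm. 4.19 / `selmerCorank_mod_two_eq W p` from the remaining named facts of the cluster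
with step (4) replaced by its three printed inputs (`selmerCorank_mod_two_eq_of_printed_tower`).
Nothing printed is weakened: the three hypotheses are the displayed statements, with the
multiplicity `m_ρ` of the `(p-1)`-dimensional
representation `ρ` of `H = Gal(F/K) ≅ D_{2p}` in `X = X_p(E/F)` (`F = M_{n+1}`, `M = M_n`,
`K = M_n ∩ ℝ`) read off from the printed identities `rk_p(E/M) = m_1 + m_ε` (Lemma 4.14:
`X_p(E/M) = X^{Gal(F/M)}`, and `ρ` has no invariants under the rotation subgroup
`Gal(F/M) ≅ C_p`) and `rk_p(E/F) = dim_{ℚ_p} X = m_1 + m_ε + (p-1) m_ρ` (p. 24: "The `p^∞`-Selmer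
rank of `E/K` is the same as the dimension of `X_p(E/K)`"; `dim 1 = dim ε = 1`, `dim ρ = p - 1`),
i.e. `(p-1) m_ρ = rk_p(E/F) - rk_p(E/M)` — so that no Galois action on Selmer groups and no real
subfield `M_n ∩ ℝ` is needed to state them. `dokchitser_selmerCorank_baseChange_mod_two_eq_holds`
itself is not here: the three leaves are unformalised theories (Selmer groups in Galois
extensions; the isogeny-invariance / Cassels–Tate machinery of §§4.1–4.3 behind Prop. 4.17; CM
points in the anticyclotomic tower), and the anticyclotomic existence rests on class field theory
(`ZpExtension.exists_isAnticyclotomic`, hypothesis `hanti`).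

Numbering as printed in the Annals text (held, `lit` key
`paper:dokchitser2010-birch-swinnerton-dyer-quotients-modulo-squares`, pp. 24–27); the arXiv
rendering `math/0610290` numbers the same items Lemma 47, Cor. 48, Prop. 50, Thm. 52.

## References

* [DokchitserDokchitserAnnals2010] T. Dokchitser, V. Dokchitser, Ann. of Math. 172 (2010),
  567–596 = arXiv:math/0610290: p. 24 (Lemma 4.14, Cor. 4.15, "fix [...] an odd prime `p`"),
  p. 25 (Prop. 4.17), pp. 26–27 (Thm. 4.19 = Thm. 1.4 and its proof).
* [CornutVatsal2007] C. Cornut, V. Vatsal, *Nontriviality of Rankin–Selberg `L`-functions and CM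
  points*, in: `L`-functions and Galois representations, LMS LNS 320 (2007), 121–186: Thm. 1.5,
  Thm. 4.2 (cited as [9] in the source).
* [Nekovar2007] J. Nekovář, *The Euler system method for CM points on Shimura curves*, ibid.,
  471–547: Thm. 3.2 (cited as [29]).
* [YuanZhangZhangAMS2013] X. Yuan, S.-W. Zhang, W. Zhang, *The Gross–Zagier formula on Shimura
  curves*, Ann. of Math. Stud. 184 (2013) (cited as [39], then a preprint).
* [Washington1997] L. C. Washington, *Introduction to Cyclotomic Fields*, §13.1 (layers of a
  `ℤ_p`-extension).
* [GreenbergLNM1716] R. Greenberg, *Iwasawa theory for elliptic curves*, LNM 1716 (1999), §1 (the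
  anticyclotomic `ℤ_p`-extension of an imaginary quadratic field).
-/

noncomputable section

open scoped Classical

open WeierstrassCurve

universe u

namespace Literature.NumberTheory.EllipticCurves

/-! ### Layers of a `ℤ_p`-extension of a number field are number fields -/

namespace ZpExtension

variable {K : Type u} [Field K] [NumberField K] {p : ℕ} [Fact p.Prime] (κ : ZpExtension K p)

/-- Each layer `K_n` of a `ℤ_p`-extension of a number field `K` is finite over `K` (of degree
`p^n`; the discharged tree fact `ZpExtension.finiteDimensional_layer`, a number field being
perfect), as an instance. Washington, *Introduction to Cyclotomic Fields*, §13.1. [cite: Washington1997, §13.1] -/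
instance finiteDimensional_layer_inst (n : ℕ) : FiniteDimensional K (κ.layer n) :=
  κ.finiteDimensional_layer_holds n

/-- Each layer `K_n` of a `ℤ_p`-extension of a number field `K` is a number field (finite over
the number field `K`, `NumberField.of_module_finite`), as an instance — so that `Sel_{p^∞}(E/K_n)`
and its corank `WeierstrassCurve.selmerCorank` make sense. Washington, §13.1. [cite: Washington1997, §13.1] -/
instance numberField_layer (n : ℕ) : NumberField (κ.layer n) :=
  NumberField.of_module_finite K _

/-- Each layer `K_n/K` is Galois (cyclic of degree `p^n`; the discharged tree fact
`ZpExtension.isGalois_layer`), as an instance. Washington, §13.1. [cite: Washington1997, §13.1] -/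
instance isGalois_layer_inst (n : ℕ) : IsGalois K (κ.layer n) :=
  κ.isGalois_layer_holds n

end ZpExtension

/-- Base change of a Weierstrass curve over `ℚ` is transitive along any algebra tower
`ℚ → A → B`, whatever the `ℚ`-algebra structure of `B`: ring homomorphisms out of `ℚ` are
unique (`Rat.subsingleton_ringHom`), and `(W.map f).map g = W.map (g ∘ f)`
(`WeierstrassCurve.map_map`). [folklore] -/
theorem baseChange_baseChange_of_rat (W : WeierstrassCurve ℚ) (A : Type*) (B : Type*)
    [CommRing A] [CommRing B] [Algebra ℚ A] [Algebra ℚ B] [Algebra A B] :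
    (W.baseChange A).baseChange B = W.baseChange B := by
  simp only [WeierstrassCurve.baseChange, WeierstrassCurve.map_map]
  congr 1
  exact Subsingleton.elim _ _

/-! ### The three printed inputs, as hypotheses

No named fact is minted here (D-0026). The three inputs of the printed proof enter the theorems
below as explicit hypotheses, always with the same three types, documented once:

* `h415` — **Corollary 4.15** (Dokchitser–Dokchitser 2010, p. 24; arXiv Cor. 48): "The parity of
  the `p^∞`-Selmer rank i[s] unchanged in cyclic `p`-extensions." It is deduced there from
  Lemma 4.14 ("Let `E/K` be an elliptic curve, and let `F/K` be a finite Galois extension with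
  Galois group `G`. Then `rk_p(E/K) = dim_{ℚ_p} X_p(E/F)^G`", with
  `X_p(E/k) = Hom(Sel_{p^∞}(E/k), ℚ_p/ℤ_p) ⊗_{ℤ_p} ℚ_p`, whose dimension is `rk_p(E/k)`) and the
  sentence "A cyclic group of order `p` has only two `ℚ_p`-irreducible `p`-adic representations,
  the trivial one and one of dimension `p - 1`. Thus," — so `rk_p(E/F) - rk_p(E/K)` is a multiple
  of `p - 1`, even for odd `p`. Used in the form that sentence proves: `F/K` Galois of (prime)
  degree `p`, hence cyclic of order `p`, with `p` odd — the standing assumption of that part of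
  §4.4 (p. 24: "Thus, fix a number field `K`, an odd prime `p`"; for `p = 2` the assertion is
  false); the case of the cyclic extension `M_n/M_0` of degree `p^n` used in §4.6 follows along
  the tower of layers (`selmerCorank_layer_succ_mod_two_eq`). Transcription: `E = W` an elliptic
  curve over the number field `K`; `F` a number field, Galois of degree `p` over `K`;
  `rk_p(E/K) = corank_{ℤ_p} Sel_{p^∞}(E/K) = W.selmerCorank p` and
  `rk_p(E/F) = (W.baseChange F).selmerCorank p` (`WeierstrassCurve.selmerCorank`, file `Selmer`):
  `∀ K W F p, p ≠ 2 → [F : K] = p → rk_p(E/F) % 2 = rk_p(E/K) % 2`.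
* `h417` — **the dihedral congruence in the anticyclotomic tower** (§4.6, proof of Thm. 4.19,
  p. 26 last paragraph – p. 27 "it suffices to show that `m_ρ` is odd"). Printed, for `E/ℚ`
  elliptic, `p` odd, `M_0` imaginary quadratic "where all bad primes of `E` split", `M_n` "the
  `n`-th layer in the anticyclotomic `ℤ_p`-extension of `M_0`" (so `Gal(M_{n+1}/ℚ)` is dihedral),
  `F = M_{n+1}`, `M = M_n`, `L = M_{n+1} ∩ ℝ`, `K = M_n ∩ ℝ`, `H = Gal(F/K) ≅ D_{2p}` with
  `ℚ_p`-irreducible representations `1`, `ε` (sign), `ρ` (`(p-1)`-dimensional): "decompose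
  `X = X_p(E/F) ≅ 1^{⊕m_1} ⊕ ε^{⊕m_ε} ⊕ ρ^{⊕m_ρ}`. As `X_p(E/K) = X^H` etc. (Lemma 4.14),
  `rk_p(E/K) = m_1`, `rk_p(E/M) = m_1 + m_ε`, `rk_p(E/L) = m_1 + (p-1)/2 · m_ρ`. Now we invoke
  Proposition 4.17: `rk_p(E/M) + m_ρ ≡ ord_p C(E/F)/C(E/M) (mod 2)`. Since all bad primes of `E`
  split in `M/K`, the root number `w(E/M) = -1` and both `C(E/F)` and `C(E/M)` are squares. So
  the right-hand side in the above formula is zero". Transcription: `E = W`, `M_0 = K` with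
  `IsImaginaryQuadratic K` and `SatisfiesHeegnerHypothesis (W.conductorNorm ℤ) K` (all primes of
  bad reduction, i.e. dividing the conductor, split), `κ : ZpExtension K p` anticyclotomic
  (`ZpExtension.IsAnticyclotomic`; unique up to `ℤ_pˣ`, with the same layers), `M_n = κ.layer n`,
  `rk_p(E/M_n) = (W.baseChange (κ.layer n)).selmerCorank p`; the multiplicity `m_ρ` is recorded
  through the printed identities as the natural number with `rk_p(E/F) = rk_p(E/M) + (p-1) m_ρ`
  (`rk_p(E/F) = dim_{ℚ_p} X = m_1 + m_ε + (p-1) m_ρ` by p. 24, "The `p^∞`-Selmer rank of `E/K`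
  is the same as the dimension of `X_p(E/K)`", and `rk_p(E/M) = m_1 + m_ε` as displayed; `ρ`
  has no invariants under the rotations `Gal(F/M) ≅ C_p`), and the conclusion is
  "`rk_p(E/M) + m_ρ` is even": `∀ n, ∃ m_ρ, rk(n+1) = rk(n) + (p-1) m_ρ ∧ Even (rk(n) + m_ρ)`.
* `hCV` — **`m_ρ = p^n` for large `n`** (p. 27, same notation): "Now take `n` large enough. Then
  Cornut–Vatsal's [9] Thm. 1.5 provides a primitive character `χ` of `Gal(F/M_0)` such that the
  twisted `L`-function `L(E/M_0, χ, s)` has a simple zero at `s = 1`. Their theorem requires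
  `N_E`, `Δ_{M_0}` and `p` to be coprime, but as they explain this is only necessary to invoke
  the Gross–Zagier–Zhang formula; this formula has now proved in complete generality by
  Yuan–Zhang–Zhang [39]. By Tian–Zhang [36] [...] the `χ`-component of `X` has multiplicity 1. So
  `X` contains exactly one copy of the unique `(p-1)p^n`-dimensional `ℚ_p`-irreducible `p`-adic
  representation of `Gal(F/ℚ)`. Its restriction to `H` is `ρ^{⊕p^n}`, and no other
  representation contributes to `ρ`, so `m_ρ = p^n` is odd. (As an alternative to the yet
  unavailable [39, 36], one may [...] combin[e] Cornut–Vatsal's [9] Thm. 4.2 with Nekovář's [29]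
  Thm. 3.2 [...])" (Cornut–Vatsal 2007, Thms. 1.5, 4.2; Nekovář 2007, Thm. 3.2). With
  `(p-1) m_ρ = rk_p(E/M_{n+1}) - rk_p(E/M_n)` as above: for all sufficiently large `n`,
  `rk_p(E/M_{n+1}) = rk_p(E/M_n) + (p-1) p^n`: `∃ n₀, ∀ n ≥ n₀, rk(n+1) = rk(n) + (p-1) p^n`.

and the existence of the anticyclotomic `ℤ_p`-extension of an imaginary quadratic field,
`hanti : ZpExtension.exists_isAnticyclotomic` (tree fact, file `ZpExtension`; Greenberg, LNM 1716,
§1), reduced in `ZpExtensionAnticyclotomicProofs` to the `ℤ_p`-rank count of class field theory.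
-/

/-! ### Climbing the anticyclotomic tower with Cor. 4.15 -/

/-- **Cor. 4.15 between consecutive layers.** For a `ℤ_p`-extension `κ` of a number field `K`
(`p` odd) and `E/ℚ`, `rk_p(E/K_{n+1}) ≡ rk_p(E/K_n) (mod 2)`: `K_{n+1}/K_n` is Galois (the top of
the Galois extension `K_{n+1}/K`, `IsGalois.tower_top_of_isGalois`) of degree
`p^{n+1}/p^n = p` (`ZpExtension.finrank_layer_holds`, tower law), so Cor. 4.15 in its degree-`p`
form (hypothesis `h415`, see the section docstring above) applies to `E/K_n`, and
`(E/K_n)/K_{n+1} = E/K_{n+1}` (`baseChange_baseChange_of_rat`). This is how Cor. 4.15 is used in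
§4.6 ("The same holds for the `p^∞`-Selmer rank (Corollary 4.15)", p. 26).
[cite: DokchitserDokchitserAnnals2010, Cor. 4.15 (p. 24) and §4.6 (p. 26)] -/
theorem selmerCorank_layer_succ_mod_two_eq
    (h415 : ∀ (K : Type) [Field K] [NumberField K] (W : WeierstrassCurve K) [W.IsElliptic]
      (F : Type) [Field F] [NumberField F] [Algebra K F] [IsGalois K F] (p : ℕ) [Fact p.Prime],
        p ≠ 2 → Module.finrank K F = p →
          (W.baseChange F).selmerCorank p % 2 = W.selmerCorank p % 2)
    (W : WeierstrassCurve ℚ) [W.IsElliptic] (p : ℕ) [Fact p.Prime] (hp : p ≠ 2)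
    {K : Type} [Field K] [NumberField K] (κ : ZpExtension K p) (n : ℕ) :
    (W.baseChange (κ.layer (n + 1))).selmerCorank p % 2 =
      (W.baseChange (κ.layer n)).selmerCorank p % 2 := by
  letI : Algebra (κ.layer n) (κ.layer (n + 1)) :=
    (IntermediateField.inclusion (κ.layer_mono n.le_succ)).toRingHom.toAlgebra
  haveI : IsScalarTower K (κ.layer n) (κ.layer (n + 1)) :=
    IsScalarTower.of_algebraMap_eq fun _ ↦ rfl
  haveI : IsGalois (κ.layer n) (κ.layer (n + 1)) := IsGalois.tower_top_of_isGalois K _ _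
  haveI : Module.Free (κ.layer n) (κ.layer (n + 1)) := Module.Free.of_divisionRing _ _
  have hdeg : Module.finrank (κ.layer n) (κ.layer (n + 1)) = p := by
    have h := Module.finrank_mul_finrank K (κ.layer n) (κ.layer (n + 1))
    rw [κ.finrank_layer_holds n, κ.finrank_layer_holds (n + 1), pow_succ] at h
    exact Nat.eq_of_mul_eq_mul_left (pow_pos (Fact.out : p.Prime).pos n) h
  have h := h415 (κ.layer n) (W.baseChange (κ.layer n)) (κ.layer (n + 1)) p hp hdeg
  rwa [baseChange_baseChange_of_rat] at h

/-- **Cor. 4.15 from the base to any layer** (`p` odd): `rk_p(E/K_{n+1}) ≡ rk_p(E/K) (mod 2)` for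
every `n`, by induction along `K ⊂ K_1 ⊂ K_2 ⊂ ⋯`: the first step is Cor. 4.15 (`h415`) for the
degree-`p` Galois extension `K_1/K` (`ZpExtension.finrank_layer_holds`, `isGalois_layer_holds`),
the later ones are `selmerCorank_layer_succ_mod_two_eq`. (Layers are indexed from `K_1` on, so
that `K` itself, rather than the isomorphic bottom layer `K_0`, appears.)
[cite: DokchitserDokchitserAnnals2010, Cor. 4.15 (p. 24) and §4.6 (p. 26)] -/
theorem selmerCorank_layer_succ_mod_two_eq_base
    (h415 : ∀ (K : Type) [Field K] [NumberField K] (W : WeierstrassCurve K) [W.IsElliptic]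
      (F : Type) [Field F] [NumberField F] [Algebra K F] [IsGalois K F] (p : ℕ) [Fact p.Prime],
        p ≠ 2 → Module.finrank K F = p →
          (W.baseChange F).selmerCorank p % 2 = W.selmerCorank p % 2)
    (W : WeierstrassCurve ℚ) [W.IsElliptic] (p : ℕ) [Fact p.Prime] (hp : p ≠ 2)
    {K : Type} [Field K] [NumberField K] (κ : ZpExtension K p) (n : ℕ) :
    (W.baseChange (κ.layer (n + 1))).selmerCorank p % 2 = (W.baseChange K).selmerCorank p % 2 := by
  induction n with
  | zero =>
    have hdeg : Module.finrank K (κ.layer 1) = p := by rw [κ.finrank_layer_holds 1, pow_one]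
    have h := h415 K (W.baseChange K) (κ.layer 1) p hp hdeg
    rwa [baseChange_baseChange_of_rat] at h
  | succ n ih => rw [selmerCorank_layer_succ_mod_two_eq h415 W p hp κ (n + 1), ih]

/-! ### The assembly, as printed -/

/-- **The `p`-parity statement for `E/M₀`, assembled as printed from its three inputs and the
anticyclotomic tower** (Dokchitser–Dokchitser 2010, §4.6, proof of Thm. 4.19, pp. 26–27): for
`E/ℚ` elliptic, `p` odd, `M₀ = K` imaginary quadratic in which all bad primes of `E` split, and
`κ` an anticyclotomic `ℤ_p`-extension of `M₀`, `rk_p(E/M₀)` is odd. Hypotheses (types documented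
in the section docstring "The three printed inputs, as hypotheses"): Cor. 4.15 (`h415`); the
dihedral congruence "`rk_p(E/M_n) + m_ρ` even" (`h417`); "`m_ρ = p^n` for `n` large" (`hCV`).
Proof, as printed: pick `n ≥ n₀` (here `n = n₀ + 1`); `hCV` and `h417` give
`(p-1) m_ρ = (p-1) p^n`, so `m_ρ = p^n` is odd (`p` odd) and `rk_p(E/M_n)` is odd; by Cor. 4.15
along `M₀ ⊂ M_1 ⊂ ⋯ ⊂ M_n` (`selmerCorank_layer_succ_mod_two_eq_base`) so is `rk_p(E/M₀)`.
[cite: DokchitserDokchitserAnnals2010, §4.6, proof of Thm. 4.19 (pp. 26–27)] [cite: CornutVatsal2007, Thm. 1.5 and Thm. 4.2] [cite: Nekovar2007, Thm. 3.2] -/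
theorem odd_selmerCorank_baseChange_of_anticyclotomic_of_printed
    (h415 : ∀ (K : Type) [Field K] [NumberField K] (W : WeierstrassCurve K) [W.IsElliptic]
      (F : Type) [Field F] [NumberField F] [Algebra K F] [IsGalois K F] (p : ℕ) [Fact p.Prime],
        p ≠ 2 → Module.finrank K F = p →
          (W.baseChange F).selmerCorank p % 2 = W.selmerCorank p % 2)
    (h417 : ∀ (W : WeierstrassCurve ℚ) [W.IsElliptic] (p : ℕ) [Fact p.Prime], p ≠ 2 →
      ∀ (K : Type) [Field K] [NumberField K], IsImaginaryQuadratic K →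
        SatisfiesHeegnerHypothesis (W.conductorNorm ℤ) K →
          ∀ (κ : ZpExtension K p), κ.IsAnticyclotomic → ∀ n : ℕ, ∃ mρ : ℕ,
            (W.baseChange (κ.layer (n + 1))).selmerCorank p =
                (W.baseChange (κ.layer n)).selmerCorank p + (p - 1) * mρ ∧
              Even ((W.baseChange (κ.layer n)).selmerCorank p + mρ))
    (hCV : ∀ (W : WeierstrassCurve ℚ) [W.IsElliptic] (p : ℕ) [Fact p.Prime], p ≠ 2 →
      ∀ (K : Type) [Field K] [NumberField K], IsImaginaryQuadratic K →
        SatisfiesHeegnerHypothesis (W.conductorNorm ℤ) K →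
          ∀ (κ : ZpExtension K p), κ.IsAnticyclotomic → ∃ n₀ : ℕ, ∀ n ≥ n₀,
            (W.baseChange (κ.layer (n + 1))).selmerCorank p =
              (W.baseChange (κ.layer n)).selmerCorank p + (p - 1) * p ^ n)
    (W : WeierstrassCurve ℚ) [W.IsElliptic] (p : ℕ) [Fact p.Prime] (hp : p ≠ 2)
    (K : Type) [Field K] [NumberField K] (hK : IsImaginaryQuadratic K)
    (hH : SatisfiesHeegnerHypothesis (W.conductorNorm ℤ) K)
    (κ : ZpExtension K p) (hκ : κ.IsAnticyclotomic) :
    Odd ((W.baseChange K).selmerCorank p) := by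
  obtain ⟨n₀, hn₀⟩ := hCV W p hp K hK hH κ hκ
  obtain ⟨m, hm, heven⟩ := h417 W p hp K hK hH κ hκ (n₀ + 1)
  have hgrow := hn₀ (n₀ + 1) (Nat.le_succ n₀)
  have hp2 : 2 ≤ p := (Fact.out : p.Prime).two_le
  have hmeq : m = p ^ (n₀ + 1) := by
    have h : (p - 1) * m = (p - 1) * p ^ (n₀ + 1) := by omega
    exact Nat.eq_of_mul_eq_mul_left (by omega) h
  have hpow : Odd (p ^ (n₀ + 1)) := ((Fact.out : p.Prime).odd_of_ne_two hp).pow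
  have hlayer : Odd ((W.baseChange (κ.layer (n₀ + 1))).selmerCorank p) := by
    rw [hmeq] at heven
    rcases heven with ⟨a, ha⟩
    rcases hpow with ⟨b, hb⟩
    exact ⟨a - b - 1, by omega⟩
  have htower := selmerCorank_layer_succ_mod_two_eq_base h415 W p hp κ n₀
  rw [Nat.odd_iff] at hlayer ⊢
  rw [← htower, hlayer]

/-- **Step (4) of the proof of Thm. 4.19 (= Thm. 1.4) from its printed inputs**: the target fact
`dokchitser_selmerCorank_baseChange_mod_two_eq` — `rk_p(E/M₀)` is odd for `E/ℚ` elliptic, `p`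
odd, `M₀` imaginary quadratic with all bad primes split — from the existence of the anticyclotomic
`ℤ_p`-extension of `M₀` (`hanti`, tree fact `ZpExtension.exists_isAnticyclotomic`, applied with
`[M₀ : ℚ] = 2` and `M₀` totally complex), Cor. 4.15 (`h415`), the dihedral congruence (`h417`)
and Cornut–Vatsal / Tian–Zhang / Nekovář (`hCV`), through
`odd_selmerCorank_baseChange_of_anticyclotomic_of_printed`. So the fact rests, up to proved
theorems, on exactly these four inputs; it is reduced, not discharged, and not weakened.
[cite: DokchitserDokchitserAnnals2010, §4.6, proof of Thm. 4.19 (= Thm. 1.4), pp. 26–27] -/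
theorem dokchitser_selmerCorank_baseChange_mod_two_eq_of_printed
    (hanti : ∀ (K : Type) [Field K] [NumberField K] (p : ℕ) [Fact p.Prime],
      ZpExtension.exists_isAnticyclotomic (K := K) (p := p))
    (h415 : ∀ (K : Type) [Field K] [NumberField K] (W : WeierstrassCurve K) [W.IsElliptic]
      (F : Type) [Field F] [NumberField F] [Algebra K F] [IsGalois K F] (p : ℕ) [Fact p.Prime],
        p ≠ 2 → Module.finrank K F = p →
          (W.baseChange F).selmerCorank p % 2 = W.selmerCorank p % 2)
    (h417 : ∀ (W : WeierstrassCurve ℚ) [W.IsElliptic] (p : ℕ) [Fact p.Prime], p ≠ 2 →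
      ∀ (K : Type) [Field K] [NumberField K], IsImaginaryQuadratic K →
        SatisfiesHeegnerHypothesis (W.conductorNorm ℤ) K →
          ∀ (κ : ZpExtension K p), κ.IsAnticyclotomic → ∀ n : ℕ, ∃ mρ : ℕ,
            (W.baseChange (κ.layer (n + 1))).selmerCorank p =
                (W.baseChange (κ.layer n)).selmerCorank p + (p - 1) * mρ ∧
              Even ((W.baseChange (κ.layer n)).selmerCorank p + mρ))
    (hCV : ∀ (W : WeierstrassCurve ℚ) [W.IsElliptic] (p : ℕ) [Fact p.Prime], p ≠ 2 →
      ∀ (K : Type) [Field K] [NumberField K], IsImaginaryQuadratic K →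
        SatisfiesHeegnerHypothesis (W.conductorNorm ℤ) K →
          ∀ (κ : ZpExtension K p), κ.IsAnticyclotomic → ∃ n₀ : ℕ, ∀ n ≥ n₀,
            (W.baseChange (κ.layer (n + 1))).selmerCorank p =
              (W.baseChange (κ.layer n)).selmerCorank p + (p - 1) * p ^ n) :
    dokchitser_selmerCorank_baseChange_mod_two_eq := by
  intro W _ p _ hp K _ _ hK hH
  haveI : NumberField.IsTotallyComplex K := hK.2
  obtain ⟨κ, hκ⟩ := hanti K p hK.1 NumberField.IsTotallyComplex.isComplex
  exact Nat.odd_iff.mp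
    (odd_selmerCorank_baseChange_of_anticyclotomic_of_printed h415 h417 hCV W p hp K hK hH κ hκ)

/-- **Thm. 4.19 (= Thm. 1.4), `rk_p(E/ℚ) ≡ ord_{s=1} L(E, s) (mod 2)`, with step (4) unfolded into
its printed inputs**: the cluster's assembly `selmerCorank_mod_two_eq_of_facts_of_exists_isNewformOf`
(`BSDSelmerParityDokchitserProofs`: modularity `hmod`, Monsky `hMon`, Waldspurger `hWa`,
Murty–Murty with Remark 1 `hMM`, Gross–Zagier–Kolyvagin `hGZK`, the Selmer rank of a quadratic
base change `hSel`) fed with `dokchitser_selmerCorank_baseChange_mod_two_eq_of_printed` in place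
of the step-(4) fact. So `selmerCorank_mod_two_eq W p` rests, along the printed proof, on:
modularity; Monsky (`p = 2`); Waldspurger 1985 and Murty–Murty 1991; Gross–Zagier–Kolyvagin; the
Selmer rank of a quadratic base change; the anticyclotomic `ℤ_p`-extension (class field theory);
Cor. 4.15; the dihedral congruence of §4.6 (Lemma 4.14, Prop. 4.17); and Cornut–Vatsal with
Tian–Zhang / Nekovář.
[cite: DokchitserDokchitserAnnals2010, Thm. 4.19 (= Thm. 1.4) and its proof, §4.6] [cite: BCDTJAMS2001, Thm. A] -/
theorem selmerCorank_mod_two_eq_of_printed_tower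
    (hmod : Literature.NumberTheory.EllipticCurves.ModularForms.exists_isNewformOf)
    (hMon : monsky_selmerCorank_two_mod_two_eq)
    (hWa : waldspurger_exists_heegnerField_twist_ne_zero)
    (hMM : murtyMurty_exists_heegnerField_twist_simpleZero_of_rootNumber_eq_one)
    (hGZK : rank_eq_analyticRank_of_analyticRank_le_one)
    (hSel : selmerCorank_baseChange_quadratic)
    (hanti : ∀ (K : Type) [Field K] [NumberField K] (p : ℕ) [Fact p.Prime],
      ZpExtension.exists_isAnticyclotomic (K := K) (p := p))
    (h415 : ∀ (K : Type) [Field K] [NumberField K] (W : WeierstrassCurve K) [W.IsElliptic]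
      (F : Type) [Field F] [NumberField F] [Algebra K F] [IsGalois K F] (p : ℕ) [Fact p.Prime],
        p ≠ 2 → Module.finrank K F = p →
          (W.baseChange F).selmerCorank p % 2 = W.selmerCorank p % 2)
    (h417 : ∀ (W : WeierstrassCurve ℚ) [W.IsElliptic] (p : ℕ) [Fact p.Prime], p ≠ 2 →
      ∀ (K : Type) [Field K] [NumberField K], IsImaginaryQuadratic K →
        SatisfiesHeegnerHypothesis (W.conductorNorm ℤ) K →
          ∀ (κ : ZpExtension K p), κ.IsAnticyclotomic → ∀ n : ℕ, ∃ mρ : ℕ,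
            (W.baseChange (κ.layer (n + 1))).selmerCorank p =
                (W.baseChange (κ.layer n)).selmerCorank p + (p - 1) * mρ ∧
              Even ((W.baseChange (κ.layer n)).selmerCorank p + mρ))
    (hCV : ∀ (W : WeierstrassCurve ℚ) [W.IsElliptic] (p : ℕ) [Fact p.Prime], p ≠ 2 →
      ∀ (K : Type) [Field K] [NumberField K], IsImaginaryQuadratic K →
        SatisfiesHeegnerHypothesis (W.conductorNorm ℤ) K →
          ∀ (κ : ZpExtension K p), κ.IsAnticyclotomic → ∃ n₀ : ℕ, ∀ n ≥ n₀,
            (W.baseChange (κ.layer (n + 1))).selmerCorank p =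
              (W.baseChange (κ.layer n)).selmerCorank p + (p - 1) * p ^ n)
    (W : WeierstrassCurve ℚ) [W.IsElliptic] (p : ℕ) [Fact p.Prime] :
    selmerCorank_mod_two_eq W p :=
  selmerCorank_mod_two_eq_of_facts_of_exists_isNewformOf hmod hMon hWa hMM hGZK hSel
    (dokchitser_selmerCorank_baseChange_mod_two_eq_of_printed hanti h415 h417 hCV) W p

end Literature.NumberTheory.EllipticCurves

end
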